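import Summits.QuantumFields.YangMills.Theorems.BalabanUVNodesN15KingModelSlicesDatumSup
import HarnessLib

/-!
# BalabanUVNodes ∕ N15 — THE KING-MODEL RUNG, CURVED EDITION (PART Ρ-f): PROPOSITION 3.7's HÖLDER CLAUSES (3.65) FOR THE DATUM `kingSliceKernels` (part Ρ-e) —
# (3.65)₁ α-UNIFORMLY, (3.65)₂ AT EACH FIXED `α ∈ (0, 1)`, every slice, uniformly in the level, the volume and the mass
# (Track A, DAG node N15 = NE2; FAN-OUT v1.1 §N15 s3 «KING-MODEL RUNG … + the one-line statement of what the curved case adds»)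

HONEST FRAMING.  Count-neutral (cell `pub-ymgap`, seat `pub-ymgap-dag-n15-e` g17; `--supports stmt-QuantumFields-27366 --as helper` = K3⁸
`SpineGivenEndpointR13SepCoPHV`).  TEMPLATE LITERATURE, `A = 0`: C. King's scalar U(1)-Higgs MODEL on finite tori ([King1986] Prop. 3.7 (3.63)–(3.65) p. 663 —
PRINTED and proved there; here DECIDED for the tree's objects at `A = 0`, `Ω = T_η`, in King's quantifier order «0 < α < 1» first (the lit-balaban leaf
`SlicePropagatorStatementsAt` v1.1 `Prop37PrintedAt`∕`Prop37KingOrder`, typed 2026-08-28 on this seat's schema note: the gradient Hölder clause has `C = C(α)`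
in print and in the model)), NOT Bałaban's covariant objects; NE2⁺ is NOT PRINTED for those and not proved; NOT a node discharge; nothing continuum ∕ ℝ⁴ ∕
OS ∕ mass-gap ∕ Clay.  0 `sorry`, 0 `def`, standard axioms.  The datum and its dictionary (King's `(L^jη)^{2−D}` normalisation and (2.20) mass scaling APPLIED
as the definition of the level-`k` kernels; `B := PEmpty`, (3.64) empty by type) are part Ρ-e's `kingSliceKernels` — HONEST SCOPE there.
* §1 ★ `kingSliceKernels_ineq365a` ((3.65)₁ for the datum, every slice, α-UNIFORM: part Ρ-b `kingSliceG_holder_le` ∕ part Ρ-c `kingSliceZero_holder_le`),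
  ★ `kingSliceKernels_ineq365b` ((3.65)₂ at fixed `α`: part Ρ-d `kingSliceDG_holder_le_at` ∕ `kingSliceZero_dholder_le_at`);
* the assembly ★★★ `prop37PrintedAt_king_zeroField` ∕ ★★★ `prop37KingOrder_king_zeroField` is the successor file `…KingModelProp37AtZeroField`.
WHAT THE CURVED CASE ADDS (one line): Prop. 3.7 for `G_(j)(Ω, A)`, regular `A ≠ 0`, `Ω ⊊ T_η`, and the contour clause (3.64) — [King1986] §4 ∕ [Ba 4]; and
the family-uniform `Prop37Printed` (α inside) is NOT the model's for (3.65)₂.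
Locators: [King1986] (3.62) p.663, Prop. 3.7 (3.63)–(3.65) p.663, (2.17) p.653, (2.20) p.654; [Balaban1983RegularityDecay] Thms (1.9)–(1.10) p.573.
-/

noncomputable section

namespace Summit.QuantumFields.YangMills.BalabanUVNodes.N15KingModelRung.Curved

open Real Finset Matrix
open Literature.MathematicalPhysics.QuantumFieldTheory.Balaban1983to89.B5Prop11Plancherel (Tor fine unitVec)
open Literature.MathematicalPhysics.QuantumFieldTheory.King1986 (aK aK_pos aK_le)
open Literature.MathematicalPhysics.QuantumFieldTheory.King1986.Torus (fineOp blockOf tdistT tdistT_nonneg tdistT_symm torCongr torCongr_add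
  torCongr_unitVec tdistT_torCongr)
open Literature.MathematicalPhysics.QuantumFieldTheory.King1986.SlicePropagator (SliceKernels Prop37PrintedAt Prop37KingOrder holderDeriv holderDeriv_def)

variable {d : ℕ} (L : ℕ) [NeZero L]

/-! ## §1 The Hölder clauses (3.65) for the datum -/

/-- ★ **(3.65)₁ FOR THE DATUM, EVERY SLICE, α-UNIFORM**: ONE `(C, δ₀)` such that for all `k ≥ 1`, cubes, masses `0 < m² ≤ m₀²`, slices `j + 1 ≤ k`, exponents
`0 < α < 1` and `x ≠ y`, `z`: `|∂_α(x, y)G_(j)(z)| ≤ C·(L^jη)^{2−D−α}·e^{−δ₀(L^jη)^{−1}min(|x−z|, |y−z|)}`. [cite: King1986, Prop. 3.7 (3.65) p.663 (first Hölder display), (3.62) p.663] -/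
theorem kingSliceKernels_ineq365a (hLodd : Odd L) (hL : 2 ≤ L) {a : ℝ} (ha : 0 < a) {m0sq : ℝ} (hm0 : 0 ≤ m0sq) :
    ∃ C δ₀ : ℝ, 0 < C ∧ 0 < δ₀ ∧ ∀ (k eM : ℕ) (hk : 1 ≤ k) (M : Fin (d + 1) → ℕ) [∀ μ, NeZero (M μ)] (hM : ∀ μ, M μ = 2 * L ^ eM)
      (msq : ℝ), 0 < msq → msq ≤ m0sq → ∀ (j : ℕ), j + 1 ≤ k → ∀ {α : ℝ}, 0 < α → α < 1 →
      ∀ x y z : Tor (fine (L ^ k) M), 0 < (kingSliceKernels L k eM M hM hk a msq).dist x y →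
      |holderDeriv (kingSliceKernels L k eM M hM hk a msq).dist α ((kingSliceKernels L k eM M hM hk a msq).G j) x y z|
        ≤ C * ((kingSliceKernels L k eM M hM hk a msq).slice j) ^ ((2 : ℝ) - (d + 1 : ℕ) - α)
            * Real.exp (-(δ₀ * ((kingSliceKernels L k eM M hM hk a msq).slice j)⁻¹
                * min ((kingSliceKernels L k eM M hM hk a msq).dist x z) ((kingSliceKernels L k eM M hM hk a msq).dist y z))) := by
  obtain ⟨C₃, δ₃, hC₃, hδ₃, H₃⟩ := kingSliceG_holder_le (d := d) L hLodd hL ha hm0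
  obtain ⟨C₆, δ₆, hC₆, hδ₆, H₆⟩ := kingSliceZero_holder_le (d := d) L hLodd hL ha hm0
  have hL0 : (0 : ℝ) < L := by exact_mod_cast Nat.pos_of_ne_zero (NeZero.ne L)
  have hL1 : (1 : ℝ) ≤ L := by exact_mod_cast Nat.one_le_iff_ne_zero.mpr (NeZero.ne L)
  have hL2 : (1 : ℝ) ≤ (L : ℝ) ^ 2 := one_le_pow₀ hL1
  set C : ℝ := C₃ + (L : ℝ) ^ 2 * C₆ with hCdef
  have hC : 0 < C := by positivity
  have hc3 : C₃ ≤ C := le_add_of_nonneg_right (by positivity)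
  have hc6 : (L : ℝ) ^ 2 * C₆ ≤ C := le_add_of_nonneg_left hC₃.le
  refine ⟨C, min δ₃ δ₆, hC, lt_min hδ₃ hδ₆, ?_⟩
  intro k eM hk M _ hM msq hmsq hcap j hj α hα0 hα1 x y z hxy
  have hLk : (0 : ℝ) < (L : ℝ) ^ k := pow_pos hL0 _
  have hmono : ∀ {δi w : ℝ}, min δ₃ δ₆ ≤ δi → 0 ≤ w → Real.exp (-(δi * w)) ≤ Real.exp (-(min δ₃ δ₆ * w)) := fun hle hw =>
    Real.exp_le_exp.mpr (neg_le_neg (mul_le_mul_of_nonneg_right hle hw))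
  rw [holderDeriv_def]
  simp only [kingSliceKernels_dist, kingSliceKernels_G] at hxy ⊢
  rw [kingSliceKernels_slice, min_div_div_right hLk.le, sliceWeight_eq hL0]
  have ht : 0 < tdistT (fine (L ^ k) M) x y := (div_pos_iff_of_pos_right hLk).mp hxy
  set m : ℝ := min (tdistT (fine (L ^ k) M) x z) (tdistT (fine (L ^ k) M) y z) with hm
  have hm0 : 0 ≤ m / (L : ℝ) ^ j := div_nonneg (le_min (tdistT_nonneg _ x z) (tdistT_nonneg _ y z)) (pow_pos hL0 _).le
  by_cases hj1 : 1 ≤ j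
  · have hjk : j < k := by omega
    rw [kingSliceG_of_pos M hM hk a msq hj1 hjk, kingSliceG_of_pos M hM hk a msq hj1 hjk]
    set s : ℝ := (L : ℝ) ^ j / (L : ℝ) ^ k with hsdef
    have hs : 0 < s := div_pos (pow_pos hL0 _) hLk
    have hs1 : s ≤ 1 := by rw [hsdef, div_le_one hLk]; exact pow_le_pow_right₀ hL1 hjk.le
    have hsD : 0 ≤ s ^ ((2 : ℝ) - (d + 1 : ℕ)) := Real.rpow_nonneg hs.le _
    have hm' : 0 < msq * s ^ 2 := by positivity
    have hmc : msq * s ^ 2 ≤ m0sq := (mul_le_of_le_one_right hmsq.le (pow_le_one₀ hs.le hs1)).trans hcap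
    have hcar := kingSliceIdx_carrier (d := d) L M hM hj1 hjk
    rw [← mul_sub]
    have h3 := H₃ (msq * s ^ 2) hm' hmc k M (kingSliceIdx k eM j hj1) hcar hα0 hα1.le x y z ht
    generalize ksSlice L a (msq * s ^ 2) (kingSliceIdx k eM j hj1) (torCongr hcar x) (torCongr hcar z)
      - ksSlice L a (msq * s ^ 2) (kingSliceIdx k eM j hj1) (torCongr hcar y) (torCongr hcar z) = Δ at h3 ⊢
    have hLj : (0 : ℝ) < (L : ℝ) ^ j := pow_pos hL0 _
    -- the weights: `(t∕L^k)^{−α}·(t∕L^j)^{α} = s^{−α}`, `s^{2−D}·s^{−α} = s^{2−D−α}`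
    have hw : (tdistT (fine (L ^ k) M) x y / (L : ℝ) ^ k) ^ (-α) * (tdistT (fine (L ^ k) M) x y / (L : ℝ) ^ (kingSliceIdx (d := d) k eM j hj1).j) ^ α
        = s ^ (-α) := by
      rw [show ((L : ℝ) ^ (kingSliceIdx (d := d) k eM j hj1).j) = (L : ℝ) ^ j from rfl, div_rpow_neg_mul_div_rpow ht hLk hLj, hsdef]
    have hsα : 0 ≤ (tdistT (fine (L ^ k) M) x y / (L : ℝ) ^ k) ^ (-α) := Real.rpow_nonneg (div_nonneg (tdistT_nonneg _ x y) hLk.le) _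
    set E₃ := Real.exp (-(δ₃ * (m / (L : ℝ) ^ j))) with hE₃
    set E := Real.exp (-(min δ₃ δ₆ * (m / (L : ℝ) ^ j))) with hE
    have hEE : E₃ ≤ E := hmono (min_le_left _ _) hm0
    have h3' : |Δ| ≤ C₃ * (tdistT (fine (L ^ k) M) x y / (L : ℝ) ^ (kingSliceIdx (d := d) k eM j hj1).j) ^ α * E₃ := by
      rw [hE₃, hm]; exact h3
    rw [abs_mul, abs_mul, abs_of_nonneg hsα, abs_of_nonneg hsD]
    calc (tdistT (fine (L ^ k) M) x y / (L : ℝ) ^ k) ^ (-α) * (s ^ ((2 : ℝ) - (d + 1 : ℕ)) * |Δ|)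
        ≤ (tdistT (fine (L ^ k) M) x y / (L : ℝ) ^ k) ^ (-α) * (s ^ ((2 : ℝ) - (d + 1 : ℕ))
            * (C₃ * (tdistT (fine (L ^ k) M) x y / (L : ℝ) ^ (kingSliceIdx (d := d) k eM j hj1).j) ^ α * E₃)) :=
          mul_le_mul_of_nonneg_left (mul_le_mul_of_nonneg_left h3' hsD) hsα
      _ = C₃ * (s ^ ((2 : ℝ) - (d + 1 : ℕ)) * ((tdistT (fine (L ^ k) M) x y / (L : ℝ) ^ k) ^ (-α)
            * (tdistT (fine (L ^ k) M) x y / (L : ℝ) ^ (kingSliceIdx (d := d) k eM j hj1).j) ^ α)) * E₃ := by ring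
      _ = C₃ * s ^ ((2 : ℝ) - (d + 1 : ℕ) - α) * E₃ := by rw [hw, rpow_mul_rpow_neg_eq hs]
      _ ≤ C * s ^ ((2 : ℝ) - (d + 1 : ℕ) - α) * E :=
          mul_le_mul (mul_le_mul_of_nonneg_right hc3 (Real.rpow_nonneg hs.le _)) hEE (Real.exp_nonneg _) (by positivity)
  · have hj0 : j = 0 := by omega
    subst hj0
    haveI := kingZeroVol_neZero (d := d) L k eM
    rw [kingSliceG_zero M hM hk a msq, kingSliceG_zero M hM hk a msq]
    set η : ℝ := (1 : ℝ) / (L : ℝ) ^ k with hηdef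
    have hη : 0 < η := by positivity
    have hηD : 0 ≤ η ^ ((2 : ℝ) - (d + 1 : ℕ)) := Real.rpow_nonneg hη.le _
    have hm' : 0 < msq * (L : ℝ) ^ 2 * η ^ 2 := by positivity
    have hLk1 : (L : ℝ) ≤ (L : ℝ) ^ k := by
      calc (L : ℝ) = (L : ℝ) ^ 1 := (pow_one _).symm
        _ ≤ (L : ℝ) ^ k := pow_le_pow_right₀ hL1 hk
    have hLη : (L : ℝ) ^ 2 * η ^ 2 ≤ 1 := by
      rw [hηdef, ← mul_pow, div_eq_mul_inv, one_mul, ← div_eq_mul_inv]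
      exact pow_le_one₀ (by positivity) ((div_le_one hLk).mpr hLk1)
    have hmc : msq * (L : ℝ) ^ 2 * η ^ 2 ≤ m0sq := by
      have : msq * ((L : ℝ) ^ 2 * η ^ 2) ≤ msq * 1 := mul_le_mul_of_nonneg_left hLη hmsq.le
      rw [mul_one, ← mul_assoc] at this
      exact this.trans hcap
    have h0car := kingZero_carrier (d := d) L M hM hk (eM := eM)
    have hslice0 : (L : ℝ) ^ 0 / (L : ℝ) ^ k = η := by rw [pow_zero, hηdef]
    rw [hslice0, pow_zero, div_one, ← mul_sub, ← mul_sub]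
    have h6 := H₆ (msq * (L : ℝ) ^ 2 * η ^ 2) hm' hmc k eM M (kingZeroVol L k eM) (fun _ => rfl) h0car hα0 hα1.le x y z ht
    generalize (fineOp (L ^ 1) (kingZeroVol L k eM) (aK a L 1) (((L ^ 1 : ℕ) : ℝ) ^ 2) (msq * (L : ℝ) ^ 2 * η ^ 2))⁻¹ (torCongr h0car x) (torCongr h0car z)
      - (fineOp (L ^ 1) (kingZeroVol L k eM) (aK a L 1) (((L ^ 1 : ℕ) : ℝ) ^ 2) (msq * (L : ℝ) ^ 2 * η ^ 2))⁻¹ (torCongr h0car y) (torCongr h0car z)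
      = Δ at h6 ⊢
    have hw : (tdistT (fine (L ^ k) M) x y / (L : ℝ) ^ k) ^ (-α) * (tdistT (fine (L ^ k) M) x y) ^ α = η ^ (-α) := by
      have := div_rpow_neg_mul_div_rpow (α := α) ht hLk one_pos
      rw [div_one] at this
      rw [this, hηdef]
    have hsα : 0 ≤ (tdistT (fine (L ^ k) M) x y / (L : ℝ) ^ k) ^ (-α) := Real.rpow_nonneg (div_nonneg (tdistT_nonneg _ x y) hLk.le) _
    have hL2pos : (0 : ℝ) < (L : ℝ) ^ 2 := by positivity
    set E₆ := Real.exp (-(δ₆ * m)) with hE₆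
    set E := Real.exp (-(min δ₃ δ₆ * m)) with hE
    have hm0' : 0 ≤ m := le_min (tdistT_nonneg _ x z) (tdistT_nonneg _ y z)
    have hEE : E₆ ≤ E := hmono (min_le_right _ _) hm0'
    have h6' : |Δ| ≤ C₆ * (tdistT (fine (L ^ k) M) x y) ^ α * E₆ := by rw [hE₆, hm]; exact h6
    rw [abs_mul, abs_mul, abs_mul, abs_of_nonneg hsα, abs_of_nonneg hηD, abs_of_pos hL2pos]
    calc (tdistT (fine (L ^ k) M) x y / (L : ℝ) ^ k) ^ (-α) * (η ^ ((2 : ℝ) - (d + 1 : ℕ)) * ((L : ℝ) ^ 2 * |Δ|))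
        ≤ (tdistT (fine (L ^ k) M) x y / (L : ℝ) ^ k) ^ (-α) * (η ^ ((2 : ℝ) - (d + 1 : ℕ)) * ((L : ℝ) ^ 2
            * (C₆ * (tdistT (fine (L ^ k) M) x y) ^ α * E₆))) :=
          mul_le_mul_of_nonneg_left (mul_le_mul_of_nonneg_left (mul_le_mul_of_nonneg_left h6' hL2pos.le) hηD) hsα
      _ = ((L : ℝ) ^ 2 * C₆) * (η ^ ((2 : ℝ) - (d + 1 : ℕ)) * ((tdistT (fine (L ^ k) M) x y / (L : ℝ) ^ k) ^ (-α)
            * (tdistT (fine (L ^ k) M) x y) ^ α)) * E₆ := by ring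
      _ = ((L : ℝ) ^ 2 * C₆) * η ^ ((2 : ℝ) - (d + 1 : ℕ) - α) * E₆ := by rw [hw, rpow_mul_rpow_neg_eq hη]
      _ ≤ C * η ^ ((2 : ℝ) - (d + 1 : ℕ) - α) * E :=
          mul_le_mul (mul_le_mul_of_nonneg_right hc6 (Real.rpow_nonneg hη.le _)) hEE (Real.exp_nonneg _) (by positivity)

/-- ★ **(3.65)₂ FOR THE DATUM AT FIXED `α ∈ (0, 1)`, EVERY SLICE**: `C = C(α)`, `δ₀ = δ₀(α)` (King's print; the model has no α-uniform constant here).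
[cite: King1986, Prop. 3.7 (3.65) p.663 (second Hölder display), (3.62) p.663] -/
theorem kingSliceKernels_ineq365b (hLodd : Odd L) (hL : 2 ≤ L) {a : ℝ} (ha : 0 < a) {m0sq : ℝ} (hm0 : 0 ≤ m0sq) {α : ℝ} (hα0 : 0 < α)
    (hα1 : α < 1) :
    ∃ C δ₀ : ℝ, 0 < C ∧ 0 < δ₀ ∧ ∀ (k eM : ℕ) (hk : 1 ≤ k) (M : Fin (d + 1) → ℕ) [∀ μ, NeZero (M μ)] (hM : ∀ μ, M μ = 2 * L ^ eM)
      (msq : ℝ), 0 < msq → msq ≤ m0sq → ∀ (j : ℕ), j + 1 ≤ k → ∀ (μ : Fin (d + 1)) (x y z : Tor (fine (L ^ k) M)),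
      0 < (kingSliceKernels L k eM M hM hk a msq).dist x y →
      |holderDeriv (kingSliceKernels L k eM M hM hk a msq).dist α ((kingSliceKernels L k eM M hM hk a msq).dG j μ) x y z|
        ≤ C * ((kingSliceKernels L k eM M hM hk a msq).slice j) ^ ((1 : ℝ) - (d + 1 : ℕ) - α)
            * Real.exp (-(δ₀ * ((kingSliceKernels L k eM M hM hk a msq).slice j)⁻¹
                * min ((kingSliceKernels L k eM M hM hk a msq).dist x z) ((kingSliceKernels L k eM M hM hk a msq).dist y z))) := by
  obtain ⟨C₄, δ₄, hC₄, hδ₄, H₄⟩ := kingSliceDG_holder_le_at (d := d) L hLodd hL ha hm0 hα0 hα1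
  obtain ⟨C₇, δ₇, hC₇, hδ₇, H₇⟩ := kingSliceZero_dholder_le_at (d := d) L hLodd hL ha hm0 hα0 hα1
  have hL0 : (0 : ℝ) < L := by exact_mod_cast Nat.pos_of_ne_zero (NeZero.ne L)
  have hL1 : (1 : ℝ) ≤ L := by exact_mod_cast Nat.one_le_iff_ne_zero.mpr (NeZero.ne L)
  set C : ℝ := C₄ + (L : ℝ) * C₇ with hCdef
  have hC : 0 < C := by positivity
  have hc4 : C₄ ≤ C := le_add_of_nonneg_right (by positivity)
  have hc7 : (L : ℝ) * C₇ ≤ C := le_add_of_nonneg_left hC₄.le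
  refine ⟨C, min δ₄ δ₇, hC, lt_min hδ₄ hδ₇, ?_⟩
  intro k eM hk M _ hM msq hmsq hcap j hj μ x y z hxy
  have hLk : (0 : ℝ) < (L : ℝ) ^ k := pow_pos hL0 _
  have hmono : ∀ {δi w : ℝ}, min δ₄ δ₇ ≤ δi → 0 ≤ w → Real.exp (-(δi * w)) ≤ Real.exp (-(min δ₄ δ₇ * w)) := fun hle hw =>
    Real.exp_le_exp.mpr (neg_le_neg (mul_le_mul_of_nonneg_right hle hw))
  rw [holderDeriv_def]
  simp only [kingSliceKernels_dist, kingSliceKernels_dG] at hxy ⊢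
  rw [kingSliceKernels_slice, min_div_div_right hLk.le, sliceWeight_eq hL0]
  have ht : 0 < tdistT (fine (L ^ k) M) x y := (div_pos_iff_of_pos_right hLk).mp hxy
  set m : ℝ := min (tdistT (fine (L ^ k) M) x z) (tdistT (fine (L ^ k) M) y z) with hm
  have hm0 : 0 ≤ m / (L : ℝ) ^ j := div_nonneg (le_min (tdistT_nonneg _ x z) (tdistT_nonneg _ y z)) (pow_pos hL0 _).le
  have hsα : 0 ≤ (tdistT (fine (L ^ k) M) x y / (L : ℝ) ^ k) ^ (-α) := Real.rpow_nonneg (div_nonneg (tdistT_nonneg _ x y) hLk.le) _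
  by_cases hj1 : 1 ≤ j
  · have hjk : j < k := by omega
    simp only [kingSliceG_of_pos M hM hk a msq hj1 hjk]
    set s : ℝ := (L : ℝ) ^ j / (L : ℝ) ^ k with hsdef
    have hs : 0 < s := div_pos (pow_pos hL0 _) hLk
    have hs1 : s ≤ 1 := by rw [hsdef, div_le_one hLk]; exact pow_le_pow_right₀ hL1 hjk.le
    have hsD' : 0 ≤ s ^ ((1 : ℝ) - (d + 1 : ℕ)) := Real.rpow_nonneg hs.le _
    have hm' : 0 < msq * s ^ 2 := by positivity
    have hmc : msq * s ^ 2 ≤ m0sq := (mul_le_of_le_one_right hmsq.le (pow_le_one₀ hs.le hs1)).trans hcap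
    have hcar := kingSliceIdx_carrier (d := d) L M hM hj1 hjk
    have h4 := H₄ (msq * s ^ 2) hm' hmc k M (kingSliceIdx k eM j hj1) hcar μ x y z ht
    rw [ksDSlice_eq_fwdDiff, ksDSlice_eq_fwdDiff, ← sliceCast_add_unitVec L _ M hcar x μ, ← sliceCast_add_unitVec L _ M hcar y μ] at h4
    have hLjeq : ((L ^ (kingSliceIdx (d := d) k eM j hj1).j : ℕ) : ℝ) = (L : ℝ) ^ j := by
      rw [show (kingSliceIdx (d := d) k eM j hj1).j = j from rfl]; push_cast; ring
    rw [hLjeq, show ((L : ℝ) ^ (kingSliceIdx (d := d) k eM j hj1).j) = (L : ℝ) ^ j from rfl] at h4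
    simp only [← mul_sub]
    generalize ksSlice L a (msq * s ^ 2) (kingSliceIdx k eM j hj1) (torCongr hcar (x + unitVec (fine (L ^ k) M) μ)) (torCongr hcar z)
      - ksSlice L a (msq * s ^ 2) (kingSliceIdx k eM j hj1) (torCongr hcar x) (torCongr hcar z) = A at h4 ⊢
    generalize ksSlice L a (msq * s ^ 2) (kingSliceIdx k eM j hj1) (torCongr hcar (y + unitVec (fine (L ^ k) M) μ)) (torCongr hcar z)
      - ksSlice L a (msq * s ^ 2) (kingSliceIdx k eM j hj1) (torCongr hcar y) (torCongr hcar z) = B at h4 ⊢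
    have hLj : (0 : ℝ) < (L : ℝ) ^ j := pow_pos hL0 _
    have hexp : (L : ℝ) ^ k * s ^ ((2 : ℝ) - (d + 1 : ℕ)) = s ^ ((1 : ℝ) - (d + 1 : ℕ)) * (L : ℝ) ^ j := by
      have e1 : s ^ ((2 : ℝ) - (d + 1 : ℕ)) = s ^ ((1 : ℝ) - (d + 1 : ℕ)) * s := by rw [rpow_mul_self_eq hs]; ring_nf
      rw [e1, hsdef]; field_simp
    have key : (L : ℝ) ^ k * (s ^ ((2 : ℝ) - (d + 1 : ℕ)) * (A - B))
        = s ^ ((1 : ℝ) - (d + 1 : ℕ)) * ((L : ℝ) ^ j * A - (L : ℝ) ^ j * B) := by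
      rw [← mul_sub, ← mul_assoc, ← mul_assoc, hexp]
    rw [key, abs_mul, abs_mul, abs_of_nonneg hsα, abs_of_nonneg hsD']
    have hw : (tdistT (fine (L ^ k) M) x y / (L : ℝ) ^ k) ^ (-α) * (tdistT (fine (L ^ k) M) x y / (L : ℝ) ^ j) ^ α = s ^ (-α) := by
      rw [div_rpow_neg_mul_div_rpow ht hLk hLj, hsdef]
    set E₄ := Real.exp (-(δ₄ * (m / (L : ℝ) ^ j))) with hE₄
    set E := Real.exp (-(min δ₄ δ₇ * (m / (L : ℝ) ^ j))) with hE
    have hEE : E₄ ≤ E := hmono (min_le_left _ _) hm0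
    have h4' : |(L : ℝ) ^ j * A - (L : ℝ) ^ j * B| ≤ C₄ * (tdistT (fine (L ^ k) M) x y / (L : ℝ) ^ j) ^ α * E₄ := by rw [hE₄, hm]; exact h4
    calc (tdistT (fine (L ^ k) M) x y / (L : ℝ) ^ k) ^ (-α) * (s ^ ((1 : ℝ) - (d + 1 : ℕ)) * |(L : ℝ) ^ j * A - (L : ℝ) ^ j * B|)
        ≤ (tdistT (fine (L ^ k) M) x y / (L : ℝ) ^ k) ^ (-α) * (s ^ ((1 : ℝ) - (d + 1 : ℕ))
            * (C₄ * (tdistT (fine (L ^ k) M) x y / (L : ℝ) ^ j) ^ α * E₄)) :=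
          mul_le_mul_of_nonneg_left (mul_le_mul_of_nonneg_left h4' hsD') hsα
      _ = C₄ * (s ^ ((1 : ℝ) - (d + 1 : ℕ)) * ((tdistT (fine (L ^ k) M) x y / (L : ℝ) ^ k) ^ (-α)
            * (tdistT (fine (L ^ k) M) x y / (L : ℝ) ^ j) ^ α)) * E₄ := by ring
      _ = C₄ * s ^ ((1 : ℝ) - (d + 1 : ℕ) - α) * E₄ := by rw [hw, rpow_mul_rpow_neg_eq hs]
      _ ≤ C * s ^ ((1 : ℝ) - (d + 1 : ℕ) - α) * E :=
          mul_le_mul (mul_le_mul_of_nonneg_right hc4 (Real.rpow_nonneg hs.le _)) hEE (Real.exp_nonneg _) (by positivity)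
  · have hj0 : j = 0 := by omega
    subst hj0
    haveI := kingZeroVol_neZero (d := d) L k eM
    simp only [kingSliceG_zero M hM hk a msq]
    set η : ℝ := (1 : ℝ) / (L : ℝ) ^ k with hηdef
    have hη : 0 < η := by positivity
    have hηD' : 0 ≤ η ^ ((1 : ℝ) - (d + 1 : ℕ)) := Real.rpow_nonneg hη.le _
    have hm' : 0 < msq * (L : ℝ) ^ 2 * η ^ 2 := by positivity
    have hLk1 : (L : ℝ) ≤ (L : ℝ) ^ k := by
      calc (L : ℝ) = (L : ℝ) ^ 1 := (pow_one _).symm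
        _ ≤ (L : ℝ) ^ k := pow_le_pow_right₀ hL1 hk
    have hLη : (L : ℝ) ^ 2 * η ^ 2 ≤ 1 := by
      rw [hηdef, ← mul_pow, div_eq_mul_inv, one_mul, ← div_eq_mul_inv]
      exact pow_le_one₀ (by positivity) ((div_le_one hLk).mpr hLk1)
    have hmc : msq * (L : ℝ) ^ 2 * η ^ 2 ≤ m0sq := by
      have : msq * ((L : ℝ) ^ 2 * η ^ 2) ≤ msq * 1 := mul_le_mul_of_nonneg_left hLη hmsq.le
      rw [mul_one, ← mul_assoc] at this
      exact this.trans hcap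
    have h0car := kingZero_carrier (d := d) L M hM hk (eM := eM)
    have hslice0 : (L : ℝ) ^ 0 / (L : ℝ) ^ k = η := by rw [pow_zero, hηdef]
    rw [hslice0, pow_zero, div_one]
    have h7 := H₇ (msq * (L : ℝ) ^ 2 * η ^ 2) hm' hmc k eM M (kingZeroVol L k eM) (fun _ => rfl) h0car μ x y z ht
    simp only [← mul_sub]
    generalize (fineOp (L ^ 1) (kingZeroVol L k eM) (aK a L 1) (((L ^ 1 : ℕ) : ℝ) ^ 2) (msq * (L : ℝ) ^ 2 * η ^ 2))⁻¹
        (torCongr h0car (x + unitVec (fine (L ^ k) M) μ)) (torCongr h0car z)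
      - (fineOp (L ^ 1) (kingZeroVol L k eM) (aK a L 1) (((L ^ 1 : ℕ) : ℝ) ^ 2) (msq * (L : ℝ) ^ 2 * η ^ 2))⁻¹
        (torCongr h0car x) (torCongr h0car z) = A at h7 ⊢
    generalize (fineOp (L ^ 1) (kingZeroVol L k eM) (aK a L 1) (((L ^ 1 : ℕ) : ℝ) ^ 2) (msq * (L : ℝ) ^ 2 * η ^ 2))⁻¹
        (torCongr h0car (y + unitVec (fine (L ^ k) M) μ)) (torCongr h0car z)
      - (fineOp (L ^ 1) (kingZeroVol L k eM) (aK a L 1) (((L ^ 1 : ℕ) : ℝ) ^ 2) (msq * (L : ℝ) ^ 2 * η ^ 2))⁻¹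
        (torCongr h0car y) (torCongr h0car z) = B at h7 ⊢
    have hexp : (L : ℝ) ^ k * η ^ ((2 : ℝ) - (d + 1 : ℕ)) = η ^ ((1 : ℝ) - (d + 1 : ℕ)) := by
      have e1 : η ^ ((2 : ℝ) - (d + 1 : ℕ)) = η ^ ((1 : ℝ) - (d + 1 : ℕ)) * η := by rw [rpow_mul_self_eq hη]; ring_nf
      rw [e1, hηdef]; field_simp
    have key : (L : ℝ) ^ k * (η ^ ((2 : ℝ) - (d + 1 : ℕ)) * ((L : ℝ) ^ 2 * (A - B)))
        = η ^ ((1 : ℝ) - (d + 1 : ℕ)) * (L : ℝ) * ((L : ℝ) * A - (L : ℝ) * B) := by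
      rw [← hexp]; ring
    rw [key, abs_mul, abs_mul, abs_mul, abs_of_nonneg hsα, abs_of_nonneg hηD', abs_of_pos hL0]
    have hw : (tdistT (fine (L ^ k) M) x y / (L : ℝ) ^ k) ^ (-α) * (tdistT (fine (L ^ k) M) x y) ^ α = η ^ (-α) := by
      have := div_rpow_neg_mul_div_rpow (α := α) ht hLk one_pos
      rw [div_one] at this
      rw [this, hηdef]
    set E₇ := Real.exp (-(δ₇ * m)) with hE₇
    set E := Real.exp (-(min δ₄ δ₇ * m)) with hE
    have hm0' : 0 ≤ m := le_min (tdistT_nonneg _ x z) (tdistT_nonneg _ y z)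
    have hEE : E₇ ≤ E := hmono (min_le_right _ _) hm0'
    have h7' : |(L : ℝ) * A - (L : ℝ) * B| ≤ C₇ * (tdistT (fine (L ^ k) M) x y) ^ α * E₇ := by rw [hE₇, hm]; exact h7
    calc (tdistT (fine (L ^ k) M) x y / (L : ℝ) ^ k) ^ (-α) * (η ^ ((1 : ℝ) - (d + 1 : ℕ)) * (L : ℝ) * |(L : ℝ) * A - (L : ℝ) * B|)
        ≤ (tdistT (fine (L ^ k) M) x y / (L : ℝ) ^ k) ^ (-α) * (η ^ ((1 : ℝ) - (d + 1 : ℕ)) * (L : ℝ)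
            * (C₇ * (tdistT (fine (L ^ k) M) x y) ^ α * E₇)) :=
          mul_le_mul_of_nonneg_left (mul_le_mul_of_nonneg_left h7' (by positivity)) hsα
      _ = ((L : ℝ) * C₇) * (η ^ ((1 : ℝ) - (d + 1 : ℕ)) * ((tdistT (fine (L ^ k) M) x y / (L : ℝ) ^ k) ^ (-α)
            * (tdistT (fine (L ^ k) M) x y) ^ α)) * E₇ := by ring
      _ = ((L : ℝ) * C₇) * η ^ ((1 : ℝ) - (d + 1 : ℕ) - α) * E₇ := by rw [hw, rpow_mul_rpow_neg_eq hη]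
      _ ≤ C * η ^ ((1 : ℝ) - (d + 1 : ℕ) - α) * E :=
          mul_le_mul (mul_le_mul_of_nonneg_right hc7 (Real.rpow_nonneg hη.le _)) hEE (Real.exp_nonneg _) (by positivity)

end Summit.QuantumFields.YangMills.BalabanUVNodes.N15KingModelRung.Curved

end
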